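import Mathlib

/-!
# `CMTwistPeriodTransfer` (stmt-KontsevichZagierPeriods-3415, route HermiteRigidity): real algebra

Helper file for the closing file `HermiteRigidityCMTwistPeriodTransfer.lean`. The curve is
`y² = f(x) = 4x³ − 120x + 224 = 4(x − 4)((x + 2)² − 18)` (`j = 8000`, CM by `ℤ[√−2]`), with real
roots `e₃ = −2 − √18 < e₂ = −2 + √18 < e₁ = 4`. In the coordinate `x` (Silverman's model
`Y² = X³ + 4X² + 2X` is `x = 3X + 4`, `y² = 108 Y²`) the `x`-coordinate of the endomorphism `[√−2]`
(Silverman, *Advanced Topics*, Prop. II.2.3.1 (ii)) is the REAL rational map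
`Ψ(x) = −x/2 − 9/(x − 4)`, with `Ψ′(x) = −1/2 + 9/(x − 4)²` and the CM identity
`f(Ψ(x)) = −f(x)·Ψ′(x)²/2` (`f_psi`), so that `dΨ/√(−f(Ψ)) = √2·dx/√f` where `f > 0`
(`weight`). `Ψ` folds the bounded oval `(e₃, e₂)` at `x₀ = 4 − √18` (`Ψ′(x₀) = 0`) onto
`(e₂, 4)`: it is injective on `(e₃, x₀)` and on `(x₀, e₂)` (`psi_injOn_left/right`) and maps each
onto `(e₂, 4)` (`psi_surjOn_left/right`, intermediate values; `Ψ(e₃) = Ψ(e₂) = 4`, `Ψ(x₀) = e₂`).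
Everything here is elementary real algebra/analysis written out explicitly (no definitions are
introduced); the typed set predicates of the route declaration are decoded in `mem_sigma_iff`
(`{0 < f ∧ x < 4} = (e₃, e₂)`) and `mem_sigma'_iff` (`{f < 0 ∧ 0 < x} = (e₂, 4)`).

References: J. H. Silverman, *Advanced Topics in the Arithmetic of Elliptic Curves* (1994),
Prop. II.2.3.1; D. Masser, *Elliptic Functions and Transcendence* (1975), Lemma 3.1.
-/

noncomputable section

open Set

namespace Summit.KontsevichZagierPeriods.HermiteRigidity.CMTwistPeriodTransfer

/-! ### The cubic and its roots -/

/-- `f(x) = 4x³ − 120x + 224 = 4(x − 4)((x + 2)² − 18)`. [folklore] -/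
theorem f_factor (x : ℝ) :
    4 * x ^ 3 - 120 * x + 224 = 4 * (x - 4) * ((x + 2) ^ 2 - 18) := by ring

/-- `0 < √18`. [folklore] -/
theorem sqrt18_pos : 0 < Real.sqrt 18 := Real.sqrt_pos.mpr (by norm_num)

/-- `(√18)² = 18`. [folklore] -/
theorem sq_sqrt18 : Real.sqrt 18 ^ 2 = 18 := Real.sq_sqrt (by norm_num)

/-- `4 < √18`. [folklore] -/
theorem four_lt_sqrt18 : 4 < Real.sqrt 18 := by
  rw [show (4 : ℝ) = Real.sqrt 16 by
    rw [show (16 : ℝ) = 4 ^ 2 by norm_num, Real.sqrt_sq (by norm_num)]]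
  exact Real.sqrt_lt_sqrt (by norm_num) (by norm_num)

/-- `√18 < 5`. [folklore] -/
theorem sqrt18_lt_five : Real.sqrt 18 < 5 := by
  rw [show (5 : ℝ) = Real.sqrt 25 by
    rw [show (25 : ℝ) = 5 ^ 2 by norm_num, Real.sqrt_sq (by norm_num)]]
  exact Real.sqrt_lt_sqrt (by norm_num) (by norm_num)

/-- The typed bounded oval: `0 < f(x) ∧ x < 4 ↔ e₃ < x < e₂` (`e₃ = −2 − √18`, `e₂ = −2 + √18`).
[folklore] -/
theorem mem_sigma_iff (x : ℝ) :
    (0 < 4 * x ^ 3 - 120 * x + 224 ∧ x < 4) ↔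
      (-2 - Real.sqrt 18 < x ∧ x < -2 + Real.sqrt 18) := by
  have hρ := sqrt18_pos
  have hρ2 := sq_sqrt18
  have h4 := four_lt_sqrt18
  have h5 := sqrt18_lt_five
  rw [f_factor]
  constructor
  · rintro ⟨hf, hx⟩
    have hx4 : x - 4 < 0 := by linarith
    have hq : (x + 2) ^ 2 - 18 < 0 := by
      by_contra h
      have : 4 * (x - 4) * ((x + 2) ^ 2 - 18) ≤ 0 :=
        mul_nonpos_of_nonpos_of_nonneg (by linarith) (le_of_not_gt h)
      linarith
    have habs : |x + 2| < Real.sqrt 18 := by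
      rw [← abs_of_pos hρ, ← sq_lt_sq, hρ2]
      linarith
    rw [abs_lt] at habs
    constructor <;> linarith [habs.1, habs.2]
  · rintro ⟨h1, h2⟩
    have habs : |x + 2| < Real.sqrt 18 := by
      rw [abs_lt]; constructor <;> linarith
    have hq : (x + 2) ^ 2 < 18 := by
      rw [← abs_of_pos hρ, ← sq_lt_sq, hρ2] at habs
      exact habs
    have hx4 : x < 4 := by linarith
    refine ⟨?_, hx4⟩
    have : 0 < (4 - x) * (18 - (x + 2) ^ 2) := mul_pos (by linarith) (by linarith)
    nlinarith [this]

/-- The typed real twisted oval: `f(x) < 0 ∧ 0 < x ↔ e₂ < x < 4`. [folklore] -/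
theorem mem_sigma'_iff (x : ℝ) :
    (4 * x ^ 3 - 120 * x + 224 < 0 ∧ 0 < x) ↔
      (-2 + Real.sqrt 18 < x ∧ x < 4) := by
  have hρ := sqrt18_pos
  have hρ2 := sq_sqrt18
  have h4 := four_lt_sqrt18
  have h5 := sqrt18_lt_five
  have hfac : ∀ x : ℝ, 4 * x ^ 3 - 120 * x + 224 =
      4 * (x - 4) * (x + 2 - Real.sqrt 18) * (x + 2 + Real.sqrt 18) := fun x => by
    rw [f_factor]; linear_combination (4 * (x - 4)) * hρ2
  rw [hfac]
  constructor
  · rintro ⟨hf, hx⟩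
    have hc : 0 < x + 2 + Real.sqrt 18 := by linarith
    have hprod : 4 * (x - 4) * (x + 2 - Real.sqrt 18) < 0 := by
      by_contra h
      have := mul_nonneg (le_of_not_gt h) hc.le
      linarith
    constructor
    · by_contra h
      have h' := le_of_not_gt h
      have ha : x + 2 - Real.sqrt 18 ≤ 0 := by linarith
      have hb : x - 4 ≤ 0 := by linarith
      have : 0 ≤ 4 * (x - 4) * (x + 2 - Real.sqrt 18) := by
        have := mul_nonneg_of_nonpos_of_nonpos hb ha
        linarith
      linarith
    · by_contra h
      have h' := le_of_not_gt h
      have ha : 0 ≤ x - 4 := by linarith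
      have hb : 0 ≤ x + 2 - Real.sqrt 18 := by linarith
      have : 0 ≤ 4 * (x - 4) * (x + 2 - Real.sqrt 18) := by
        have := mul_nonneg ha hb
        linarith
      linarith
  · rintro ⟨h1, h2⟩
    have hx : 0 < x := by linarith
    refine ⟨?_, hx⟩
    have hb : 0 < x + 2 - Real.sqrt 18 := by linarith
    have hc : 0 < x + 2 + Real.sqrt 18 := by linarith
    have : 0 < (4 - x) * (x + 2 - Real.sqrt 18) * (x + 2 + Real.sqrt 18) :=
      mul_pos (mul_pos (by linarith) hb) hc
    nlinarith [this]

/-- Left half `(e₃, x₀)` of the bounded oval, `x₀ = 4 − √18`: the typed description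
`0 < f(x) ∧ x < 4 ∧ 18 < (x − 4)²` implies `e₃ < x < x₀`. [folklore] -/
theorem bounds_left (x : ℝ) (h : 0 < 4 * x ^ 3 - 120 * x + 224 ∧ x < 4)
    (h18 : 18 < (x - 4) ^ 2) : -2 - Real.sqrt 18 < x ∧ x < 4 - Real.sqrt 18 := by
  have hx := (mem_sigma_iff x).1 h
  refine ⟨hx.1, ?_⟩
  have habs : |Real.sqrt 18| < |x - 4| := by rw [← sq_lt_sq, sq_sqrt18]; exact h18
  rw [abs_of_pos sqrt18_pos, abs_of_neg (by linarith [h.2])] at habs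
  linarith

/-- Conversely `e₃ < x < x₀` implies the typed description of the left half. [folklore] -/
theorem mem_left (x : ℝ) (h : -2 - Real.sqrt 18 < x ∧ x < 4 - Real.sqrt 18) :
    (0 < 4 * x ^ 3 - 120 * x + 224 ∧ x < 4) ∧ 18 < (x - 4) ^ 2 := by
  have h4 := four_lt_sqrt18
  refine ⟨(mem_sigma_iff x).2 ⟨h.1, by linarith [h.2]⟩, ?_⟩
  have h1 : Real.sqrt 18 < 4 - x := by linarith [h.2]
  nlinarith [sq_sqrt18, sqrt18_pos, h1]

/-- Right half `(x₀, e₂)` of the bounded oval: the typed description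
`0 < f(x) ∧ x < 4 ∧ (x − 4)² < 18` implies `x₀ < x < e₂`. [folklore] -/
theorem bounds_right (x : ℝ) (h : 0 < 4 * x ^ 3 - 120 * x + 224 ∧ x < 4)
    (h18 : (x - 4) ^ 2 < 18) : 4 - Real.sqrt 18 < x ∧ x < -2 + Real.sqrt 18 := by
  have hx := (mem_sigma_iff x).1 h
  refine ⟨?_, hx.2⟩
  have habs : |x - 4| < |Real.sqrt 18| := by rw [← sq_lt_sq, sq_sqrt18]; exact h18
  rw [abs_of_pos sqrt18_pos, abs_of_neg (by linarith [h.2])] at habs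
  linarith

/-- Conversely `x₀ < x < e₂` implies the typed description of the right half. [folklore] -/
theorem mem_right (x : ℝ) (h : 4 - Real.sqrt 18 < x ∧ x < -2 + Real.sqrt 18) :
    (0 < 4 * x ^ 3 - 120 * x + 224 ∧ x < 4) ∧ (x - 4) ^ 2 < 18 := by
  have h4 := four_lt_sqrt18
  have h5 := sqrt18_lt_five
  refine ⟨(mem_sigma_iff x).2 ⟨by linarith [h.1], h.2⟩, ?_⟩
  have h1 : 4 - x < Real.sqrt 18 := by linarith [h.1]
  have h2 : 0 < 4 - x := by linarith [h.2]
  nlinarith [sq_sqrt18, sqrt18_pos, h1, h2]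

/-! ### The real `x`-coordinate `Ψ` of `[√−2]` -/

/-- `Ψ(x) = −x/2 − 9/(x − 4) = ((x − 2)² + 14)/(2(4 − x)) > 0` for `x < 4`. [folklore] -/
theorem psi_pos (x : ℝ) (hx : x < 4) : 0 < -x / 2 - 9 / (x - 4) := by
  have h4 : x - 4 ≠ 0 := by linarith
  have h4' : (0:ℝ) < 4 - x := by linarith
  rw [show -x / 2 - 9 / (x - 4) = ((x - 2) ^ 2 + 14) / (2 * (4 - x)) by
    field_simp; ring]
  positivity

/-- **The CM identity** `f(Ψ(x)) = −f(x)·Ψ′(x)²/2` (`x ≠ 4`): the endomorphism `[√−2]` pulls the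
invariant differential back to `√−2` times itself. [cite: SilvermanATAEC1994, Prop. II.2.3.1] -/
theorem f_psi (x : ℝ) (hx : x ≠ 4) :
    4 * (-x / 2 - 9 / (x - 4)) ^ 3 - 120 * (-x / 2 - 9 / (x - 4)) + 224 =
      -(4 * x ^ 3 - 120 * x + 224) * (-1 / 2 + 9 / (x - 4) ^ 2) ^ 2 / 2 := by
  have h4 : x - 4 ≠ 0 := sub_ne_zero.mpr hx
  field_simp
  ring

/-- `Ψ(a) − Ψ(b) = (a − b)(18 − (a − 4)(b − 4))/(2(a − 4)(b − 4))`. [folklore] -/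
theorem psi_sub_psi (a b : ℝ) (ha : a ≠ 4) (hb : b ≠ 4) :
    (-a / 2 - 9 / (a - 4)) - (-b / 2 - 9 / (b - 4)) =
      (a - b) * (18 - (a - 4) * (b - 4)) / (2 * ((a - 4) * (b - 4))) := by
  have h4 : a - 4 ≠ 0 := sub_ne_zero.mpr ha
  have h4' : b - 4 ≠ 0 := sub_ne_zero.mpr hb
  field_simp
  ring

/-- `Ψ′(x) = −1/2 + 9/(x − 4)² = (18 − (x − 4)²)/(2(x − 4)²)`. [folklore] -/
theorem psi'_eq (x : ℝ) (hx : x ≠ 4) :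
    (-1 / 2 + 9 / (x - 4) ^ 2 : ℝ) = (18 - (x - 4) ^ 2) / (2 * (x - 4) ^ 2) := by
  have h4 : x - 4 ≠ 0 := sub_ne_zero.mpr hx
  field_simp
  ring

/-- `Ψ′(x) ≠ 0` off the fold points `(x − 4)² = 18`. [folklore] -/
theorem psi'_ne_zero (x : ℝ) (hx : x ≠ 4) (h18 : (x - 4) ^ 2 ≠ 18) :
    (-1 / 2 + 9 / (x - 4) ^ 2 : ℝ) ≠ 0 := by
  rw [psi'_eq x hx]
  have h4 : x - 4 ≠ 0 := sub_ne_zero.mpr hx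
  exact div_ne_zero (sub_ne_zero.mpr (Ne.symm h18)) (by positivity)

/-- `Ψ` has derivative `Ψ′(x)` at every `x ≠ 4`. [folklore] -/
theorem hasDerivAt_psi (x : ℝ) (hx : x ≠ 4) :
    HasDerivAt (fun y : ℝ => -y / 2 - 9 / (y - 4)) (-1 / 2 + 9 / (x - 4) ^ 2) x := by
  have h4 : x - 4 ≠ 0 := sub_ne_zero.mpr hx
  have h1 : HasDerivAt (fun y : ℝ => -y / 2) (-1 / 2) x :=
    ((hasDerivAt_id' x).neg).div_const 2
  have h2 : HasDerivAt (fun y : ℝ => y - 4) 1 x := (hasDerivAt_id' x).sub_const 4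
  have h3 : HasDerivAt (fun y : ℝ => 9 / (y - 4)) ((0 * (x - 4) - 9 * 1) / (x - 4) ^ 2) x :=
    (hasDerivAt_const x (9:ℝ)).div h2 h4
  refine (h1.sub h3).congr_deriv ?_
  field_simp
  ring

/-- `Ψ` is continuous on every set avoiding the pole `x = 4`. [folklore] -/
theorem continuousOn_psi {s : Set ℝ} (hs : ∀ x ∈ s, x ≠ 4) :
    ContinuousOn (fun y : ℝ => -y / 2 - 9 / (y - 4)) s :=
  fun x hx => ((hasDerivAt_psi x (hs x hx)).continuousAt).continuousWithinAt

/-- `Ψ(e₃) = 4`. [folklore] -/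
theorem psi_left : -(-2 - Real.sqrt 18) / 2 - 9 / (-2 - Real.sqrt 18 - 4) = 4 := by
  have hρ := sqrt18_pos
  have hρ2 := sq_sqrt18
  have h : (-2 - Real.sqrt 18 - 4) ≠ 0 := by linarith
  field_simp
  nlinarith [hρ2]

/-- `Ψ(x₀) = e₂` at the fold point `x₀ = 4 − √18`. [folklore] -/
theorem psi_mid : -(4 - Real.sqrt 18) / 2 - 9 / (4 - Real.sqrt 18 - 4) = -2 + Real.sqrt 18 := by
  have hρ := sqrt18_pos
  have hρ2 := sq_sqrt18
  have h : (4 - Real.sqrt 18 - 4) ≠ 0 := by linarith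
  field_simp
  nlinarith [hρ2]

/-- `Ψ(e₂) = 4`. [folklore] -/
theorem psi_right : -(-2 + Real.sqrt 18) / 2 - 9 / (-2 + Real.sqrt 18 - 4) = 4 := by
  have hρ := sqrt18_pos
  have hρ2 := sq_sqrt18
  have h5 := sqrt18_lt_five
  have h : (-2 + Real.sqrt 18 - 4) ≠ 0 := by linarith
  field_simp
  nlinarith [hρ2]

/-- `Ψ` is injective on the left half `(e₃, x₀)`: there `(a − 4)(b − 4) > 18`. [folklore] -/
theorem psi_injOn_left :
    InjOn (fun y : ℝ => -y / 2 - 9 / (y - 4)) (Ioo (-2 - Real.sqrt 18) (4 - Real.sqrt 18)) := by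
  intro a ha b hb hab
  have hρ := sqrt18_pos
  have ha4 : a ≠ 4 := by linarith [ha.2]
  have hb4 : b ≠ 4 := by linarith [hb.2]
  have hab' : -a / 2 - 9 / (a - 4) = -b / 2 - 9 / (b - 4) := hab
  have h := psi_sub_psi a b ha4 hb4
  rw [hab', sub_self] at h
  have hden : (2 * ((a - 4) * (b - 4))) ≠ 0 :=
    mul_ne_zero two_ne_zero (mul_ne_zero (sub_ne_zero.mpr ha4) (sub_ne_zero.mpr hb4))
  have hnum : (a - b) * (18 - (a - 4) * (b - 4)) = 0 := by
    rcases (div_eq_zero_iff).1 h.symm with h0 | h0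
    · exact h0
    · exact absurd h0 hden
  rcases mul_eq_zero.1 hnum with h0 | h0
  · linarith
  · exfalso
    have h1 : Real.sqrt 18 < 4 - a := by linarith [ha.2]
    have h2 : Real.sqrt 18 < 4 - b := by linarith [hb.2]
    have : Real.sqrt 18 * Real.sqrt 18 < (4 - a) * (4 - b) :=
      mul_lt_mul'' h1 h2 hρ.le hρ.le
    nlinarith [sq_sqrt18, this]

/-- `Ψ` is injective on the right half `(x₀, e₂)`: there `0 < (a − 4)(b − 4) < 18`. [folklore] -/
theorem psi_injOn_right :
    InjOn (fun y : ℝ => -y / 2 - 9 / (y - 4)) (Ioo (4 - Real.sqrt 18) (-2 + Real.sqrt 18)) := by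
  intro a ha b hb hab
  have hρ := sqrt18_pos
  have h5 := sqrt18_lt_five
  have ha4 : a ≠ 4 := by linarith [ha.2]
  have hb4 : b ≠ 4 := by linarith [hb.2]
  have hab' : -a / 2 - 9 / (a - 4) = -b / 2 - 9 / (b - 4) := hab
  have h := psi_sub_psi a b ha4 hb4
  rw [hab', sub_self] at h
  have hden : (2 * ((a - 4) * (b - 4))) ≠ 0 :=
    mul_ne_zero two_ne_zero (mul_ne_zero (sub_ne_zero.mpr ha4) (sub_ne_zero.mpr hb4))
  have hnum : (a - b) * (18 - (a - 4) * (b - 4)) = 0 := by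
    rcases (div_eq_zero_iff).1 h.symm with h0 | h0
    · exact h0
    · exact absurd h0 hden
  rcases mul_eq_zero.1 hnum with h0 | h0
  · linarith
  · exfalso
    have h1 : 4 - a < Real.sqrt 18 := by linarith [ha.1]
    have h2 : 4 - b < Real.sqrt 18 := by linarith [hb.1]
    have h1' : 0 < 4 - a := by linarith [ha.2]
    have h2' : 0 < 4 - b := by linarith [hb.2]
    have : (4 - a) * (4 - b) < Real.sqrt 18 * Real.sqrt 18 :=
      mul_lt_mul'' h1 h2 h1'.le h2'.le
    nlinarith [sq_sqrt18, this]

/-- `Ψ` maps the left half ONTO `(e₂, 4)` (intermediate values between `Ψ(x₀) = e₂` and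
`Ψ(e₃) = 4`). [folklore] -/
theorem psi_surjOn_left :
    Ioo (-2 + Real.sqrt 18) 4 ⊆
      (fun y : ℝ => -y / 2 - 9 / (y - 4)) '' Ioo (-2 - Real.sqrt 18) (4 - Real.sqrt 18) := by
  have hρ := sqrt18_pos
  have hc : ContinuousOn (fun y : ℝ => -y / 2 - 9 / (y - 4))
      (Icc (-2 - Real.sqrt 18) (4 - Real.sqrt 18)) :=
    continuousOn_psi fun x hx => by linarith [hx.2]
  have h := intermediate_value_Ioo' (show -2 - Real.sqrt 18 ≤ 4 - Real.sqrt 18 by linarith) hc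
  rwa [psi_left, psi_mid] at h

/-- `Ψ` maps the right half ONTO `(e₂, 4)` (intermediate values between `Ψ(x₀) = e₂` and
`Ψ(e₂) = 4`). [folklore] -/
theorem psi_surjOn_right :
    Ioo (-2 + Real.sqrt 18) 4 ⊆
      (fun y : ℝ => -y / 2 - 9 / (y - 4)) '' Ioo (4 - Real.sqrt 18) (-2 + Real.sqrt 18) := by
  have hρ := sqrt18_pos
  have h4 := four_lt_sqrt18
  have h5 := sqrt18_lt_five
  have hc : ContinuousOn (fun y : ℝ => -y / 2 - 9 / (y - 4))
      (Icc (4 - Real.sqrt 18) (-2 + Real.sqrt 18)) :=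
    continuousOn_psi fun x hx => by linarith [hx.2]
  have h := intermediate_value_Ioo (show 4 - Real.sqrt 18 ≤ -2 + Real.sqrt 18 by linarith) hc
  rwa [psi_mid, psi_right] at h

/-- `Ψ(x)` lies in the typed twisted oval `{f < 0 ∧ 0 < x}` whenever `f(x) > 0`, `x < 4` and
`x` is not a fold point (CM identity + `Ψ > 0`). [folklore] -/
theorem psi_mem_sigma' (x : ℝ) (hf : 0 < 4 * x ^ 3 - 120 * x + 224) (hx : x < 4)
    (h18 : (x - 4) ^ 2 ≠ 18) :
    4 * (-x / 2 - 9 / (x - 4)) ^ 3 - 120 * (-x / 2 - 9 / (x - 4)) + 224 < 0 ∧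
      0 < -x / 2 - 9 / (x - 4) := by
  have hx4 : x ≠ 4 := ne_of_lt hx
  refine ⟨?_, psi_pos x hx⟩
  rw [f_psi x hx4]
  have hψ := psi'_ne_zero x hx4 h18
  have : 0 < (4 * x ^ 3 - 120 * x + 224) * (-1 / 2 + 9 / (x - 4) ^ 2) ^ 2 / 2 := by positivity
  linarith

/-- **The rule-2 weight.** Where `f(x) > 0` (off the pole and the fold points),
`1/(√2·√f(x)) = (1/√(−f(Ψ x)))/2 · |Ψ′(x)|`, i.e. `dΨ/√(−f(Ψ)) = √2·dx/√f`.
[cite: SilvermanATAEC1994, Prop. II.2.3.1] -/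
theorem weight (x : ℝ) (hf : 0 < 4 * x ^ 3 - 120 * x + 224) (hx : x ≠ 4)
    (h18 : (x - 4) ^ 2 ≠ 18) :
    1 / (Real.sqrt 2 * Real.sqrt (4 * x ^ 3 - 120 * x + 224)) =
      1 / Real.sqrt (-(4 * (-x / 2 - 9 / (x - 4)) ^ 3 - 120 * (-x / 2 - 9 / (x - 4)) + 224)) / 2 *
        |(-1 / 2 + 9 / (x - 4) ^ 2 : ℝ)| := by
  rw [f_psi x hx]
  have hψ := psi'_ne_zero x hx h18
  set F : ℝ := 4 * x ^ 3 - 120 * x + 224 with hF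
  set D : ℝ := (-1 / 2 + 9 / (x - 4) ^ 2) with hD
  have hFD : -(-F * D ^ 2 / 2) = F * D ^ 2 / 2 := by ring
  rw [hFD]
  have hsq : Real.sqrt (F * D ^ 2 / 2) = Real.sqrt F * |D| / Real.sqrt 2 := by
    rw [Real.sqrt_div (by positivity), Real.sqrt_mul hf.le, Real.sqrt_sq_eq_abs]
  rw [hsq]
  have hu : 0 < Real.sqrt F := Real.sqrt_pos.mpr hf
  have hv : 0 < |D| := abs_pos.mpr hψ
  have hw : 0 < Real.sqrt 2 := Real.sqrt_pos.mpr (by norm_num)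
  have hw2 : Real.sqrt 2 * Real.sqrt 2 = 2 := Real.mul_self_sqrt (by norm_num)
  field_simp
  linarith [hw2]

end Summit.KontsevichZagierPeriods.HermiteRigidity.CMTwistPeriodTransfer

end
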